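import Literature.AlgebraicGeometry.AbelianSchemes.RigidifiedLineBundleComap
import HarnessLib

/-!
# Locality on the test scheme of the universal property of a Poincaré datum

Layer `Literature/AlgebraicGeometry/AbelianSchemes`, namespace `Literature.AlgebraicGeometry.AbelianSchemes`.
Setting: an abelian scheme `A/S`, a second abelian scheme `B/S` (the would-be dual) and a module `𝒫` on
`A ×_S B` (the would-be Poincaré sheaf).  A SOLUTION for a test datum `(f : T → S, ℒ)` — `ℒ` a line bundle on `A_T`
rigidified along the zero section and fibrewise in `Pic⁰` (`AbelianSchemeOver.RigidifiedLineBundle`,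
`AbelianSchemes/AbelianSchemeDualPair`) — is an `S`-morphism `g : T → B` with `(1_A × g)^* 𝒫 ≅ ℒ`.  Results:

* §1 `prodMap f₁ f₂ w hw : A_{T₁} ⟶ A_{T₂}` (the morphism `1_A × w` for `w ≫ f₂ = f₁`, the base equation being an
  ARGUMENT so that no associativity cast enters a type), its calculus (`prodMap_id`, `prodMap_comp`,
  `prodMap_comp_baseChangeToProd`, …) and `restrictSolutionIso` (solutions restrict along `w`);
* §2 `RigidifiedLineBundle.comapAlong ℒ w hw` — restriction of a rigidified `Pic⁰` datum along `w`
  (`RigidifiedLineBundle.comap` of `AbelianSchemes/RigidifiedLineBundleComap` transported along `hw`), with module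
  `(1_A × w)^* ℒ.L`; `castBase` (transport along an equality of base morphisms);
* §3 **`classify_unique_of_affine`** — UNIQUENESS of solutions on every `T` from uniqueness on AFFINE test schemes
  (Mathlib `Scheme.Cover.hom_ext` on `T.affineCover`);
* §4 the property `RigidifiedGluing A B 𝒫 : Prop` — for `𝒫` rigidified along `ε_A × 1_B`: an `S`-morphism
  `g : T → B` such that `(1_A × g)^* 𝒫` and `ℒ` become isomorphic on the members `A_{U_i}` of an open cover of `T`
  is a solution (the normalised local isomorphisms glue; [MumfordAV1970, §13, proof of the Thm. p. 125, with §5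
  Cor. 6]).  It is a displayed hypothesis of §5, proved for `A` an abelian variety over a field in the sequel
  `AbelianVarieties/RigidifiedGluing`;
* §5 **`existsUnique_classify_of_affine`** — `∃!` on every `T` from `∃!` on AFFINE test schemes, given
  `RigidifiedGluing A B 𝒫`: the unique affine solutions on `T.affineCover` agree on the overlaps `U_i ×_T U_j` by §3,
  hence glue (Mathlib `Scheme.Cover.glueMorphisms`, [GortzWedhorn2020, Prop. 3.5]); uniqueness is §3.

This is the reduction «it suffices to treat affine `T`» in the proof that `(A^∨, 𝒫)` represents the Picard functor
`T ↦ {ℒ on A_T rigidified, fibrewise in Pic⁰}/≅` ([MumfordAV1970, §13 p. 125], [MilneAV2008, I §8 Thm. 8.9]).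
Everything is proved; no named facts (`RigidifiedGluing` is a predicate taken as a hypothesis, not asserted).

## References
* [MumfordAV1970] D. Mumford, *Abelian Varieties* (1970), §13 (Thm. p. 125 and its proof), §5 Cor. 6 (p. 54), §8.
* [MilneAV2008] J. S. Milne, *Abelian Varieties* (v2.00, 2008), I §8 pp. 36–37 (Thm. 8.9 and its proof).
* [GortzWedhorn2020] U. Görtz, T. Wedhorn, *Algebraic Geometry I*, 2nd ed. (2020), Prop. 3.5 (gluing of morphisms, p. 69), Section (4.7) (pp. 107–108).
-/

universe u

open CategoryTheory CategoryTheory.Limits AlgebraicGeometry MonoidalCategory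

noncomputable section

-- `Scheme.Modules` / `SheafOfModules` are not reducible (as in Mathlib's `AlgebraicGeometry/Modules/Sheaf.lean`).
set_option backward.isDefEq.respectTransparency false

namespace Literature.AlgebraicGeometry.AbelianSchemes

open Literature.AlgebraicGeometry.Motives Literature.AlgebraicGeometry.AbelianVarieties
  Literature.AlgebraicGeometry.Modules

namespace AbelianSchemeOver

variable {S : Scheme.{u}} (A : AbelianSchemeOver S)

/-! ### §1 `1_A × w : A_{T₁} ⟶ A_{T₂}` with the base equation as an argument -/

section ProdMap

variable {T₁ T₂ T₃ : Scheme.{u}}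

/-- **`1_A × w : A_{T₁} = A ×_S T₁ ⟶ A ×_S T₂ = A_{T₂}`** for `w : T₁ → T₂` with `w ≫ f₂ = f₁` (non-Prop plumbing; the
equation is an argument so that no associativity cast enters the types). [cite: GortzWedhorn2020, Section (4.7) (pp. 107–108)] -/
def prodMap (f₁ : T₁ ⟶ S) (f₂ : T₂ ⟶ S) (w : T₁ ⟶ T₂) (hw : w ≫ f₂ = f₁) :
    (A.baseChange f₁).X.left ⟶ (A.baseChange f₂).X.left :=
  pullback.lift (pullback.fst A.X.hom f₁) (pullback.snd A.X.hom f₁ ≫ w)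
    (by rw [pullback.condition, Category.assoc, hw])

/-- `(1_A × w) ≫ pr_A = pr_A`. [cite: GortzWedhorn2020, Section (4.7) (pp. 107–108)] -/
@[reassoc]
theorem prodMap_fst (f₁ : T₁ ⟶ S) (f₂ : T₂ ⟶ S) (w : T₁ ⟶ T₂) (hw : w ≫ f₂ = f₁) :
    A.prodMap f₁ f₂ w hw ≫ pullback.fst A.X.hom f₂ = pullback.fst A.X.hom f₁ :=
  pullback.lift_fst _ _ _

/-- `(1_A × w) ≫ pr_{T₂} = pr_{T₁} ≫ w`. [cite: GortzWedhorn2020, Section (4.7) (pp. 107–108)] -/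
@[reassoc]
theorem prodMap_snd (f₁ : T₁ ⟶ S) (f₂ : T₂ ⟶ S) (w : T₁ ⟶ T₂) (hw : w ≫ f₂ = f₁) :
    A.prodMap f₁ f₂ w hw ≫ pullback.snd A.X.hom f₂ = pullback.snd A.X.hom f₁ ≫ w :=
  pullback.lift_snd _ _ _

/-- `1_A × w` depends only on `w`. [cite: GortzWedhorn2020, Section (4.7) (pp. 107–108)] -/
theorem prodMap_congr (f₁ : T₁ ⟶ S) (f₂ : T₂ ⟶ S) {w w' : T₁ ⟶ T₂} (h : w = w') (hw : w ≫ f₂ = f₁)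
    (hw' : w' ≫ f₂ = f₁) : A.prodMap f₁ f₂ w hw = A.prodMap f₁ f₂ w' hw' := by
  subst h
  rfl

/-- `1_A × 𝟙 = 𝟙`. [cite: GortzWedhorn2020, Section (4.7) (pp. 107–108)] -/
theorem prodMap_id (f : T₁ ⟶ S) (h : 𝟙 T₁ ≫ f = f) : A.prodMap f f (𝟙 T₁) h = 𝟙 _ := by
  apply pullback.hom_ext
  · rw [prodMap_fst, Category.id_comp]
  · rw [prodMap_snd, Category.id_comp, Category.comp_id]

/-- `(1_A × w) ≫ (1_A × w′) = 1_A × (w ≫ w′)`. [cite: GortzWedhorn2020, Section (4.7) (pp. 107–108)] -/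
@[reassoc]
theorem prodMap_comp (f₁ : T₁ ⟶ S) (f₂ : T₂ ⟶ S) (f₃ : T₃ ⟶ S) (w : T₁ ⟶ T₂) (hw : w ≫ f₂ = f₁)
    (w' : T₂ ⟶ T₃) (hw' : w' ≫ f₃ = f₂) :
    A.prodMap f₁ f₂ w hw ≫ A.prodMap f₂ f₃ w' hw' =
      A.prodMap f₁ f₃ (w ≫ w') (by rw [Category.assoc, hw', hw]) := by
  apply pullback.hom_ext
  · rw [Category.assoc, prodMap_fst, prodMap_fst, prodMap_fst]
  · rw [Category.assoc, prodMap_snd, prodMap_snd_assoc, prodMap_snd]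

/-- `restrictLeft` IS `prodMap` (for the literal composite base). [cite: GortzWedhorn2020, Section (4.7) (pp. 107–108)] -/
theorem restrictLeft_eq_prodMap {T T' : Scheme.{u}} (f : T ⟶ S) (u : T' ⟶ T) :
    A.restrictLeft f u = A.prodMap (u ≫ f) f u rfl := by
  apply pullback.hom_ext
  · rw [restrictLeft_fst, prodMap_fst]
  · rw [restrictLeft_snd, prodMap_snd]

/-- **`(1_A × w) ≫ (1_A × g) = 1_A × (w ≫ g)`** (the square with `baseChangeToProd`). [cite: MilneAV2008, I §8 pp. 36–37] -/
@[reassoc]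
theorem prodMap_comp_baseChangeToProd (B : AbelianSchemeOver S) (f₁ : T₁ ⟶ S) (f₂ : T₂ ⟶ S) (w : T₁ ⟶ T₂)
    (hw : w ≫ f₂ = f₁) (g : T₂ ⟶ B.X.left) (hg : g ≫ B.X.hom = f₂) :
    A.prodMap f₁ f₂ w hw ≫ A.baseChangeToProd B f₂ g hg =
      A.baseChangeToProd B f₁ (w ≫ g) (by rw [Category.assoc, hg, hw]) := by
  apply pullback.hom_ext
  · rw [Category.assoc, baseChangeToProd_fst, baseChangeToProd_fst, prodMap_fst]
  · rw [Category.assoc, baseChangeToProd_snd, baseChangeToProd_snd, prodMap_snd_assoc]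

/-- The identity sections are compatible with `1_A × w`: `ε_{T₁} ≫ (1_A × w) = w ≫ ε_{T₂}`.
[cite: GortzWedhorn2020, Remark 16.54 (p. 539)] -/
@[reassoc]
theorem unitSection_comp_prodMap (f₁ : T₁ ⟶ S) (f₂ : T₂ ⟶ S) (w : T₁ ⟶ T₂) (hw : w ≫ f₂ = f₁) :
    (A.baseChange f₁).unitSection ≫ A.prodMap f₁ f₂ w hw = w ≫ (A.baseChange f₂).unitSection := by
  apply pullback.hom_ext
  · rw [Category.assoc, prodMap_fst, unitSection_baseChange_comp_fst, Category.assoc,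
      unitSection_baseChange_comp_fst, ← Category.assoc, hw]
  · have h₁ : (A.baseChange f₁).unitSection ≫ pullback.snd A.X.hom f₁ = 𝟙 _ := (A.baseChange f₁).unitSection_comp_hom
    have h₂ : (A.baseChange f₂).unitSection ≫ pullback.snd A.X.hom f₂ = 𝟙 _ := (A.baseChange f₂).unitSection_comp_hom
    rw [Category.assoc, prodMap_snd, ← Category.assoc, h₁, Category.id_comp, Category.assoc, h₂, Category.comp_id]

end ProdMap

/-! ### §2 Solutions and rigidified `Pic⁰` data restrict along `1_A × w` -/

section Restrict

variable (B : AbelianSchemeOver S) (P : (A.prodLeft B).Modules) {T₁ T₂ : Scheme.{u}}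

/-- **Solutions restrict**: from `(1_A × g)^* 𝒫 ≅ L` on `A_{T₂}` to `(1_A × (w ≫ g))^* 𝒫 ≅ (1_A × w)^* L` on `A_{T₁}`.
[cite: MilneAV2008, I §8 pp. 36–37] [cite: MumfordAV1970, §13 (p. 125)] -/
def restrictSolutionIso {f₁ : T₁ ⟶ S} {f₂ : T₂ ⟶ S} (w : T₁ ⟶ T₂) (hw : w ≫ f₂ = f₁) {g : T₂ ⟶ B.X.left}
    (hg : g ≫ B.X.hom = f₂) {L : (A.baseChange f₂).X.left.Modules}
    (e : (Scheme.Modules.pullback (A.baseChangeToProd B f₂ g hg)).obj P ≅ L) :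
    (Scheme.Modules.pullback (A.baseChangeToProd B f₁ (w ≫ g) (by rw [Category.assoc, hg, hw]))).obj P ≅
      (Scheme.Modules.pullback (A.prodMap f₁ f₂ w hw)).obj L :=
  (Scheme.Modules.pullbackCongr (A.prodMap_comp_baseChangeToProd B f₁ f₂ w hw g hg).symm).app P ≪≫
    ((Scheme.Modules.pullbackComp _ _).app P).symm ≪≫ (Scheme.Modules.pullback (A.prodMap f₁ f₂ w hw)).mapIso e

end Restrict

namespace RigidifiedLineBundle

variable {A} {T₁ T₂ : Scheme.{u}} {f₁ : T₁ ⟶ S} {f₂ : T₂ ⟶ S} (ℒ : A.RigidifiedLineBundle f₂)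

/-- **Restriction of a rigidified line bundle along `w : T₁ → T₂` with `w ≫ f₂ = f₁`**: module `(1_A × w)^* ℒ`,
rigidified by `ε_{T₁}^* (1_A × w)^* ℒ ≅ w^* ε_{T₂}^* ℒ ≅ w^* 𝒪 ≅ 𝒪` (`unitSection_comp_prodMap`).
[cite: MilneAV2008, I §8 pp. 36–37] -/
def comapAlong (w : T₁ ⟶ T₂) (hw : w ≫ f₂ = f₁) : A.RigidifiedLineBundle f₁ where
  L := (Scheme.Modules.pullback (A.prodMap f₁ f₂ w hw)).obj ℒ.L
  hasRank_one := hasRank_pullback _ ℒ.hasRank_one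
  rigid := ℒ.rigid.map fun r =>
    (Scheme.Modules.pullbackComp _ _).app ℒ.L ≪≫
      (Scheme.Modules.pullbackCongr (A.unitSection_comp_prodMap f₁ f₂ w hw)).app ℒ.L ≪≫
      ((Scheme.Modules.pullbackComp _ _).app ℒ.L).symm ≪≫
      (Scheme.Modules.pullback w).mapIso r ≪≫ pullbackUnitIso w

/-- The module of `ℒ.comapAlong w hw` is `(1_A × w)^* ℒ` (definitional). [cite: MilneAV2008, I §8 pp. 36–37] -/
@[simp]
theorem comapAlong_L (w : T₁ ⟶ T₂) (hw : w ≫ f₂ = f₁) :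
    (ℒ.comapAlong w hw).L = (Scheme.Modules.pullback (A.prodMap f₁ f₂ w hw)).obj ℒ.L :=
  rfl

/-- Transport of a rigidified line bundle along an equality of base morphisms (cast). [folklore] -/
def castBase {T : Scheme.{u}} {f f' : T ⟶ S} (h : f = f') (ℒ : A.RigidifiedLineBundle f) : A.RigidifiedLineBundle f' :=
  h ▸ ℒ

/-- The cast preserves the fibrewise-`Pic⁰` condition. [cite: MilneAV2008, I §8 pp. 36–37] -/
theorem castBase_fibrewisePicZero {T : Scheme.{u}} {f f' : T ⟶ S} (h : f = f') {ℒ : A.RigidifiedLineBundle f}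
    (hℒ : ℒ.FibrewisePicZero) : (castBase h ℒ).FibrewisePicZero := by
  subst h
  exact hℒ

/-- The module of the cast is the module (through `1_A × 𝟙 = 𝟙`). [cite: MilneAV2008, I §8 pp. 36–37] -/
theorem nonempty_castBase_L_iso {T : Scheme.{u}} {f f' : T ⟶ S} (h : f = f') (ℒ : A.RigidifiedLineBundle f) :
    Nonempty ((castBase h ℒ).L ≅
      (Scheme.Modules.pullback (A.prodMap f' f (𝟙 T) (by rw [Category.id_comp, h]))).obj ℒ.L) := by
  subst h
  exact ⟨((Scheme.Modules.pullbackId _).app ℒ.L).symm ≪≫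
    (Scheme.Modules.pullbackCongr (A.prodMap_id f (Category.id_comp f)).symm).app ℒ.L⟩

/-- **`ℒ.comapAlong w hw` is fibrewise in `Pic⁰` if `ℒ` is** (through (0a)'s `FibrewisePicZero.comap` and the cast
along `hw`: `comapAlong w hw` and `castBase hw (comap w)` have isomorphic modules, and `FibrewisePicZero` only depends
on the module up to isomorphism fibrewise). [cite: MumfordAV1970, §8 ((iv) ⇔ (i))] [cite: MilneAV2008, I §8 pp. 36–37] -/
theorem comapAlong_fibrewisePicZero {ℒ : A.RigidifiedLineBundle f₂} (hℒ : ℒ.FibrewisePicZero) (w : T₁ ⟶ T₂)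
    (hw : w ≫ f₂ = f₁) : (ℒ.comapAlong w hw).FibrewisePicZero := by
  subst hw
  -- over the literal composite, `comapAlong w rfl` has module `(1_A × w)^* ℒ = restrictLeft^* ℒ ≅ (ℒ.comap w).L`
  intro Ω _ _ t
  have h := FibrewisePicZero.comap hℒ w Ω t
  refine (isHomogeneous_iff_of_iso _ ?_).1 h
  exact (Scheme.Modules.pullback _).mapIso (ℒ.comapLIso w ≪≫
    (Scheme.Modules.pullbackCongr (A.restrictLeft_eq_prodMap f₂ w)).app ℒ.L)

end RigidifiedLineBundle

/-! ### §3 UNIQUENESS of solutions is local on the test scheme -/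

section Locality

variable (B : AbelianSchemeOver S) (P : (A.prodLeft B).Modules)

/-- **Uniqueness on every `T` from uniqueness on affine test schemes.**  If, for every AFFINE `T′ → S` and every rigidified
line bundle `ℒ′` on `A_{T′}` fibrewise in `Pic⁰`, two solutions `g₁, g₂ : T′ → B` of `(1_A × g)^* 𝒫 ≅ ℒ′` coincide, then
the same holds on every `T` (restrict to `T.affineCover` with `comapAlong`, Mathlib `Scheme.Cover.hom_ext`).
[cite: MumfordAV1970, §13 (p. 125)] [cite: GortzWedhorn2020, Prop. 3.5] -/
theorem classify_unique_of_affine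
    (huniq : ∀ (T' : Scheme.{u}) [IsAffine T'] (f' : T' ⟶ S) (ℒ' : A.RigidifiedLineBundle f'), ℒ'.FibrewisePicZero →
      ∀ (g₁ g₂ : T' ⟶ B.X.left) (h₁ : g₁ ≫ B.X.hom = f') (h₂ : g₂ ≫ B.X.hom = f'),
        Nonempty ((Scheme.Modules.pullback (A.baseChangeToProd B f' g₁ h₁)).obj P ≅ ℒ'.L) →
        Nonempty ((Scheme.Modules.pullback (A.baseChangeToProd B f' g₂ h₂)).obj P ≅ ℒ'.L) → g₁ = g₂)
    {T : Scheme.{u}} (f : T ⟶ S) (ℒ : A.RigidifiedLineBundle f) (hℒ : ℒ.FibrewisePicZero)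
    (g₁ g₂ : T ⟶ B.X.left) (h₁ : g₁ ≫ B.X.hom = f) (h₂ : g₂ ≫ B.X.hom = f)
    (e₁ : Nonempty ((Scheme.Modules.pullback (A.baseChangeToProd B f g₁ h₁)).obj P ≅ ℒ.L))
    (e₂ : Nonempty ((Scheme.Modules.pullback (A.baseChangeToProd B f g₂ h₂)).obj P ≅ ℒ.L)) : g₁ = g₂ :=
  Scheme.Cover.hom_ext T.affineCover g₁ g₂ fun i =>
    huniq (T.affineCover.X i) (T.affineCover.f i ≫ f) (ℒ.comapAlong (T.affineCover.f i) rfl)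
      (RigidifiedLineBundle.comapAlong_fibrewisePicZero hℒ _ rfl) _ _
      (by rw [Category.assoc, h₁]) (by rw [Category.assoc, h₂])
      (e₁.map fun e => A.restrictSolutionIso B P (T.affineCover.f i) rfl h₁ e)
      (e₂.map fun e => A.restrictSolutionIso B P (T.affineCover.f i) rfl h₂ e)

/-! ### §4 The rigidified gluing property -/

/-- **The rigidified gluing property** of `(A, B, 𝒫)`: provided `𝒫` is rigidified along `ε_A × 1_B`, for every
test datum `(f : T → S, ℒ)`, every `S`-morphism `g : T → B` and every open cover `𝒰` of `T`, if `(1_A × g)^* 𝒫` and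
`ℒ` become isomorphic after restriction to every `A_{U_i}`, then they are isomorphic on `A_T` (the local
isomorphisms, normalised along the zero section, differ on overlaps by units with `ε`-value `1` and glue).  A
predicate, used as a hypothesis of `existsUnique_classify_of_affine`; proved for abelian varieties over a field in
`AbelianVarieties/RigidifiedGluing`. [cite: MumfordAV1970, §13 (proof of the Thm. p. 125) with §5 Cor. 6 (p. 54)] [cite: MilneAV2008, I §8 (proof of Thm. 8.9)] -/
def RigidifiedGluing {S : Scheme.{u}} (A B : AbelianSchemeOver S) (P : (A.prodLeft B).Modules) : Prop :=
  Nonempty ((Scheme.Modules.pullback (A.unitSlice B)).obj P ≅ SheafOfModules.unit _) →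
    ∀ {T : Scheme.{u}} (f : T ⟶ S) (ℒ : A.RigidifiedLineBundle f) (g : T ⟶ B.X.left) (hg : g ≫ B.X.hom = f)
      (𝒰 : Scheme.OpenCover.{u} T),
      (∀ i, Nonempty ((Scheme.Modules.pullback (A.prodMap (𝒰.f i ≫ f) f (𝒰.f i) rfl)).obj
          ((Scheme.Modules.pullback (A.baseChangeToProd B f g hg)).obj P) ≅ (ℒ.comapAlong (𝒰.f i) rfl).L)) →
      Nonempty ((Scheme.Modules.pullback (A.baseChangeToProd B f g hg)).obj P ≅ ℒ.L)

/-! ### §5 EXISTENCE AND UNIQUENESS are local on the test scheme -/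

/-- **`∃!` on every `T` from `∃!` on AFFINE test schemes** (given the rigidified gluing property §4 and the
rigidification of `𝒫`): cover `T` by `T.affineCover`; the unique affine solutions agree on the overlaps `U_i ×_T U_j`
by §3 (applied to the overlap scheme and the restricted datum), hence glue (Mathlib `Scheme.Cover.glueMorphisms`);
the global isomorphism is the gluing property; uniqueness is §3. [cite: MumfordAV1970, §13 (p. 125)] [cite: MilneAV2008, I §8 (Thm. 8.9)]
[cite: GortzWedhorn2020, Prop. 3.5] -/
theorem existsUnique_classify_of_affine (hglue : A.RigidifiedGluing B P)
    (hP : Nonempty ((Scheme.Modules.pullback (A.unitSlice B)).obj P ≅ SheafOfModules.unit _))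
    (haff : ∀ (T' : Scheme.{u}) [IsAffine T'] (f' : T' ⟶ S) (ℒ' : A.RigidifiedLineBundle f'), ℒ'.FibrewisePicZero →
      ∃! g : {g : T' ⟶ B.X.left // g ≫ B.X.hom = f'},
        Nonempty ((Scheme.Modules.pullback (A.baseChangeToProd B f' g.1 g.2)).obj P ≅ ℒ'.L))
    {T : Scheme.{u}} (f : T ⟶ S) (ℒ : A.RigidifiedLineBundle f) (hℒ : ℒ.FibrewisePicZero) :
    ∃! g : {g : T ⟶ B.X.left // g ≫ B.X.hom = f},
      Nonempty ((Scheme.Modules.pullback (A.baseChangeToProd B f g.1 g.2)).obj P ≅ ℒ.L) := by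
  -- uniqueness on affine test schemes, read off `haff`
  have huniq : ∀ (T' : Scheme.{u}) [IsAffine T'] (f' : T' ⟶ S) (ℒ' : A.RigidifiedLineBundle f'), ℒ'.FibrewisePicZero →
      ∀ (g₁ g₂ : T' ⟶ B.X.left) (h₁ : g₁ ≫ B.X.hom = f') (h₂ : g₂ ≫ B.X.hom = f'),
        Nonempty ((Scheme.Modules.pullback (A.baseChangeToProd B f' g₁ h₁)).obj P ≅ ℒ'.L) →
        Nonempty ((Scheme.Modules.pullback (A.baseChangeToProd B f' g₂ h₂)).obj P ≅ ℒ'.L) → g₁ = g₂ :=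
    fun T' _ f' ℒ' hℒ' g₁ g₂ h₁ h₂ e₁ e₂ =>
      congrArg Subtype.val ((haff T' f' ℒ' hℒ').unique (y₁ := ⟨g₁, h₁⟩) (y₂ := ⟨g₂, h₂⟩) e₁ e₂)
  -- the affine cover and the local solutions
  let 𝒰 := T.affineCover
  have hsol := fun i => haff (𝒰.X i) (𝒰.f i ≫ f) (ℒ.comapAlong (𝒰.f i) rfl)
    (RigidifiedLineBundle.comapAlong_fibrewisePicZero hℒ _ rfl)
  let gi : ∀ i, {g : 𝒰.X i ⟶ B.X.left // g ≫ B.X.hom = 𝒰.f i ≫ f} := fun i => (hsol i).exists.choose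
  have hgi : ∀ i, Nonempty ((Scheme.Modules.pullback (A.baseChangeToProd B (𝒰.f i ≫ f) (gi i).1 (gi i).2)).obj P ≅
      (ℒ.comapAlong (𝒰.f i) rfl).L) := fun i => (hsol i).exists.choose_spec
  -- compatibility on the overlaps `V = U_i ×_T U_j`: both restrictions solve the restricted problem on `V`
  have hcompat : ∀ i j, pullback.fst (𝒰.f i) (𝒰.f j) ≫ (gi i).1 = pullback.snd (𝒰.f i) (𝒰.f j) ≫ (gi j).1 := by
    intro i j
    -- the datum on `V` restricted from `U_i`
    let fV : pullback (𝒰.f i) (𝒰.f j) ⟶ S := pullback.fst (𝒰.f i) (𝒰.f j) ≫ 𝒰.f i ≫ f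
    have hji : (pullback.snd (𝒰.f i) (𝒰.f j) ≫ 𝒰.f j) ≫ f = fV := by
      rw [Category.assoc, ← pullback.condition_assoc]
    let ℒV := (ℒ.comapAlong (𝒰.f i) rfl).comapAlong (pullback.fst (𝒰.f i) (𝒰.f j)) rfl
    have hℒV : ℒV.FibrewisePicZero :=
      RigidifiedLineBundle.comapAlong_fibrewisePicZero (RigidifiedLineBundle.comapAlong_fibrewisePicZero hℒ _ rfl) _ rfl
    -- solution 1: `fst ≫ g_i`
    have s₁ : Nonempty ((Scheme.Modules.pullback (A.baseChangeToProd B fV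
        (pullback.fst (𝒰.f i) (𝒰.f j) ≫ (gi i).1) (by rw [Category.assoc, (gi i).2]))).obj P ≅ ℒV.L) :=
      (hgi i).map fun e => A.restrictSolutionIso B P (pullback.fst (𝒰.f i) (𝒰.f j)) rfl (gi i).2 e
    -- solution 2: `snd ≫ g_j`, a solution for the datum restricted from `U_j` ALONG `hji` (same base `fV`)
    have s₂' : Nonempty ((Scheme.Modules.pullback (A.baseChangeToProd B fV
        (pullback.snd (𝒰.f i) (𝒰.f j) ≫ (gi j).1) (by rw [Category.assoc, (gi j).2, ← Category.assoc, hji]))).obj P ≅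
        ((ℒ.comapAlong (𝒰.f j) rfl).comapAlong (pullback.snd (𝒰.f i) (𝒰.f j)) hji).L) :=
      (hgi j).map fun e => A.restrictSolutionIso B P (pullback.snd (𝒰.f i) (𝒰.f j)) hji (gi j).2 e
    -- the two restricted data have isomorphic modules: both are `(1_A × (V → T))^* ℒ`
    have hLL : Nonempty (((ℒ.comapAlong (𝒰.f j) rfl).comapAlong (pullback.snd (𝒰.f i) (𝒰.f j)) hji).L ≅ ℒV.L) := by
      refine ⟨(Scheme.Modules.pullbackComp _ _).app ℒ.L ≪≫
        (Scheme.Modules.pullbackCongr ?_).app ℒ.L ≪≫ ((Scheme.Modules.pullbackComp _ _).app ℒ.L).symm⟩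
      rw [prodMap_comp, prodMap_comp]
      exact A.prodMap_congr _ _ pullback.condition.symm _ _
    have s₂ : Nonempty ((Scheme.Modules.pullback (A.baseChangeToProd B fV
        (pullback.snd (𝒰.f i) (𝒰.f j) ≫ (gi j).1) (by rw [Category.assoc, (gi j).2, ← Category.assoc, hji]))).obj P ≅
        ℒV.L) :=
      s₂'.elim fun e => hLL.map fun e' => e ≪≫ e'
    exact A.classify_unique_of_affine B P huniq fV ℒV hℒV _ _ _ _ s₁ s₂
  -- glue
  let g : T ⟶ B.X.left := Scheme.Cover.glueMorphisms 𝒰 (fun i => (gi i).1) hcompat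
  have hgι : ∀ i, 𝒰.f i ≫ g = (gi i).1 := fun i => Scheme.Cover.ι_glueMorphisms 𝒰 _ hcompat i
  have hg : g ≫ B.X.hom = f :=
    Scheme.Cover.hom_ext 𝒰 _ _ fun i => by rw [← Category.assoc, hgι i, (gi i).2]
  -- the global isomorphism: the gluing property, fed with the local solutions
  have hloc : ∀ i, Nonempty ((Scheme.Modules.pullback (A.prodMap (𝒰.f i ≫ f) f (𝒰.f i) rfl)).obj
      ((Scheme.Modules.pullback (A.baseChangeToProd B f g hg)).obj P) ≅ (ℒ.comapAlong (𝒰.f i) rfl).L) := by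
    intro i
    refine (hgi i).map fun e => ?_
    exact (Scheme.Modules.pullbackComp _ _).app P ≪≫
      (Scheme.Modules.pullbackCongr (A.prodMap_comp_baseChangeToProd B _ f (𝒰.f i) rfl g hg)).app P ≪≫
      (Scheme.Modules.pullbackCongr (A.baseChangeToProd_congr B _ (hgι i) _ (gi i).2)).app P ≪≫ e
  have hex : Nonempty ((Scheme.Modules.pullback (A.baseChangeToProd B f g hg)).obj P ≅ ℒ.L) := hglue hP f ℒ g hg 𝒰 hloc
  refine ⟨⟨g, hg⟩, hex, fun g' hg' => Subtype.ext ?_⟩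
  exact A.classify_unique_of_affine B P huniq f ℒ hℒ g'.1 g g'.2 hg hg' hex

end Locality

end AbelianSchemeOver

end Literature.AlgebraicGeometry.AbelianSchemes

end
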